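import Mathlib
import Summits.Ventures.PercRepro2.Defs
import Summits.Ventures.PercRepro2.Independence
import Summits.Ventures.PercRepro2.Harris
import Summits.Ventures.PercRepro2.Graph
import Summits.Ventures.PercRepro2.Exploration
import Summits.Ventures.PercRepro2.Events
import Summits.Ventures.PercRepro2.FourFunctions
import Summits.Ventures.PercRepro2.Induced
import Summits.Ventures.PercRepro2.Frontier
import Summits.Ventures.PercRepro2.ObsIndependence
import Summits.Ventures.PercRepro2.BHK
import Summits.Ventures.PercRepro2.BHKEvents
import Summits.Ventures.PercRepro2.VdBKahn
import Summits.Ventures.PercRepro2.BHKAvoid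
import Summits.Ventures.PercRepro2.OrderPreservation
import Summits.Ventures.PercRepro2.OrderPreservationQuant

/-!
# HF2 — the o-free four-point inequality behind (Yu2) is a theorem (blind cell PercRepro2, p1)

Roots `b`, `l` (light), `h` (heavy), `t` (the third root) with the labelling
`P(l ↔ b) ≤ P(h ↔ b)`; `C_x` = cluster of `x`. With
`R′ = {l ∉ C_h, t ∉ C_h}`, `PD = R′ ∩ {t ↮ l}`, `T = {l ∉ C_h, t ∈ C_h}`,
`N_l = P(l ↔ b, R′)`, `M_h = P(PD, h ↔ b)`, `Δ_T = P(h ↔ b, T) − P(l ↔ b, T)`,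
`gap = P(h ↔ b) − P(l ↔ b)` (`proofs/P1-HF2.md`; CONJECTURES row 2′H):

* `hf2_cov` — the covariance step: `P(h ↔ b, t ↔ l, R′) · P(R′) ≤ P(h ↔ b, R′) · P(t ↔ l, R′)`
  (BHK Thm 1.4 with the avoided set `{l, t}`, `bhk_cross_cluster_avoid`; equivalently the two
  increasing functionals `1{b ∈ C_h}` and `P_{G∖C_h}(t ↮ l)` of the heavy cluster are positively
  associated under `{C_h ∩ {l, t} = ∅}`);
* `hf2_gap_split` — the identity `gap = (P(h ↔ b, R′) − N_l) + Δ_T` (split `{l ∉ C_h}` by the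
  position of `t`; the common part `{h, l, b connected}` cancels);
* `hf2_slack_ge` — hypothesis-free: `(M_h + Δ_T) · P(R′) − N_l · P(PD) ≥ gap · P(PD) + Δ_T · P(R′, t ↔ l)`;
* `hf2_deltaT_nonneg` — `Δ_T ≥ 0` under the labelling (R10, `orderPreserving_quant_mul` with
  `s = h`, `o = t`, `y = l`);
* `hf2` — **HF2**: `N_l · P(PD) ≤ (M_h + Δ_T) · P(R′)` under the labelling, and `hf2_quant`, the
  quantitative form with the slack `gap · P(PD) + Δ_T · P(R′, t ↔ l)`.

`hf2` closes the last open piece of the (Y) skeleton: with the lead's (Yu1), (N0) and the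
heavy-first reduction (Yu2) ⇐ HF2 (`proofs/LEAD-PROOFSHAPES.md` §8.9 ADDENDUM 10 (10d)),
(Y) ⇒ SC″|ord ⇒ SC′ ⇒ R2′(3) is a theorem on paper.
-/

namespace Summit.Ventures.PercRepro2

section HF2

variable {V : Type*} {E : Type*} [Fintype E] [DecidableEq E] [Fintype V] [DecidableEq V]
  {R : Type*} [Field R] [LinearOrder R] [IsStrictOrderedRing R]

omit [Fintype E] [DecidableEq E] [Fintype V] in
/-- `{h ↮ l, h ↮ t}` is `avoidAll ends h {l, t}`. -/
lemma hf2_avoidAll_pair (ends : E → Sym2 V) (h l t : V) :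
    avoidAll ends h {l, t} = (connEvent ends h l)ᶜ ∩ (connEvent ends h t)ᶜ := by
  ext ω
  simp only [avoidAll, Set.mem_setOf_eq, Finset.mem_insert, Finset.mem_singleton,
    forall_eq_or_imp, forall_eq, Set.mem_inter_iff, Set.mem_compl_iff, mem_connEvent]

omit [Fintype E] [DecidableEq E] [Fintype V] [DecidableEq V] in
/-- On `{h ↔ l}`, `h ↔ b` is the same as `l ↔ b`. -/
lemma hf2_common_eq (ends : E → Sym2 V) (h l b : V) :
    connEvent ends h b ∩ connEvent ends h l = connEvent ends l b ∩ connEvent ends h l := by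
  ext ω
  simp only [Set.mem_inter_iff, mem_connEvent]
  exact ⟨fun ⟨h1, h2⟩ => ⟨conn_trans (conn_symm h2) h1, h2⟩,
    fun ⟨h1, h2⟩ => ⟨conn_trans h2 h1, h2⟩⟩

omit [Fintype E] [DecidableEq E] [Fintype V] [DecidableEq V] in
/-- `{h ↔ l, h ↔ b, l ↮ b}` is empty (transitivity). -/
lemma hf2_triangle_empty (ends : E → Sym2 V) (h l b : V) :
    connEvent ends h l ∩ connEvent ends h b ∩ (connEvent ends l b)ᶜ = ∅ := by
  ext ω
  simp only [Set.mem_inter_iff, Set.mem_compl_iff, mem_connEvent, Set.mem_empty_iff_false,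
    iff_false, not_and, not_not]
  exact fun ⟨h1, h2⟩ => conn_trans (conn_symm h1) h2

/-- **The covariance step of HF2** (BHK06 Thm 1.4 with the avoided set `{l, t}`):
`P(h ↔ b, t ↔ l, R′) · P(R′) ≤ P(h ↔ b, R′) · P(t ↔ l, R′)`, `R′ = {h ↮ l, h ↮ t}`. -/
theorem hf2_cov (p : E → R) (hp : IsProbVec p) (ends : E → Sym2 V) (h l t b : V) :
    prob p (connEvent ends h b ∩ connEvent ends t l ∩
          ((connEvent ends h l)ᶜ ∩ (connEvent ends h t)ᶜ)) *
        prob p ((connEvent ends h l)ᶜ ∩ (connEvent ends h t)ᶜ) ≤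
      prob p (connEvent ends h b ∩ ((connEvent ends h l)ᶜ ∩ (connEvent ends h t)ᶜ)) *
        prob p (connEvent ends t l ∩ ((connEvent ends h l)ᶜ ∩ (connEvent ends h t)ᶜ)) := by
  have key := bhk_cross_cluster_avoid p hp ends h t (X := {l, t}) (by simp)
    (isUpperSet_mem_setOf b) (isUpperSet_mem_setOf l)
  rw [hf2_avoidAll_pair, ← connEvent_eq_clusterInEvent, ← connEvent_eq_clusterInEvent] at key
  exact key

omit [Fintype V] [DecidableEq V] in
/-- **The gap identity**: `P(h ↔ b) − P(l ↔ b) = (P(h ↔ b, R′) − P(l ↔ b, R′)) + Δ_T`, where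
`R′ = {h ↮ l, h ↮ t}` and `Δ_T = P(h ↔ b, T) − P(l ↔ b, T)`, `T = {h ↮ l, h ↔ t}`. -/
theorem hf2_gap_split (p : E → R) (ends : E → Sym2 V) (h l t b : V) :
    prob p (connEvent ends h b) - prob p (connEvent ends l b) =
      (prob p (connEvent ends h b ∩ ((connEvent ends h l)ᶜ ∩ (connEvent ends h t)ᶜ)) -
          prob p (connEvent ends l b ∩ ((connEvent ends h l)ᶜ ∩ (connEvent ends h t)ᶜ))) +
        (prob p (connEvent ends h b ∩ ((connEvent ends h l)ᶜ ∩ connEvent ends h t)) -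
          prob p (connEvent ends l b ∩ ((connEvent ends h l)ᶜ ∩ connEvent ends h t))) := by
  have s1 := prob_inter_add_prob_inter_compl p (connEvent ends h b) (connEvent ends h l)
  have s2 := prob_inter_add_prob_inter_compl p (connEvent ends h b ∩ (connEvent ends h l)ᶜ)
    (connEvent ends h t)
  have s3 := prob_inter_add_prob_inter_compl p (connEvent ends l b) (connEvent ends h l)
  have s4 := prob_inter_add_prob_inter_compl p (connEvent ends l b ∩ (connEvent ends h l)ᶜ)
    (connEvent ends h t)
  rw [hf2_common_eq] at s1
  rw [Set.inter_assoc, Set.inter_assoc] at s2 s4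
  linarith

/-- **HF2, hypothesis-free quantitative form**: with `R′ = {h ↮ l, h ↮ t}`, `PD = R′ ∩ {t ↮ l}`,
`T = {h ↮ l, h ↔ t}`, `N_l = P(l ↔ b, R′)`, `M_h = P(PD, h ↔ b)`, `Δ_T = P(h ↔ b, T) − P(l ↔ b, T)`,
`gap = P(h ↔ b) − P(l ↔ b)`:
`(M_h + Δ_T) · P(R′) − N_l · P(PD) ≥ gap · P(PD) + Δ_T · P(t ↔ l, R′)`. -/
theorem hf2_slack_ge (p : E → R) (hp : IsProbVec p) (ends : E → Sym2 V) (h l t b : V) :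
    (prob p ((connEvent ends h l)ᶜ ∩ (connEvent ends h t)ᶜ ∩ (connEvent ends t l)ᶜ ∩
            connEvent ends h b) +
          (prob p (connEvent ends h b ∩ ((connEvent ends h l)ᶜ ∩ connEvent ends h t)) -
            prob p (connEvent ends l b ∩ ((connEvent ends h l)ᶜ ∩ connEvent ends h t)))) *
        prob p ((connEvent ends h l)ᶜ ∩ (connEvent ends h t)ᶜ) -
      prob p (connEvent ends l b ∩ ((connEvent ends h l)ᶜ ∩ (connEvent ends h t)ᶜ)) *
        prob p ((connEvent ends h l)ᶜ ∩ (connEvent ends h t)ᶜ ∩ (connEvent ends t l)ᶜ) ≥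
    (prob p (connEvent ends h b) - prob p (connEvent ends l b)) *
        prob p ((connEvent ends h l)ᶜ ∩ (connEvent ends h t)ᶜ ∩ (connEvent ends t l)ᶜ) +
      (prob p (connEvent ends h b ∩ ((connEvent ends h l)ᶜ ∩ connEvent ends h t)) -
          prob p (connEvent ends l b ∩ ((connEvent ends h l)ᶜ ∩ connEvent ends h t))) *
        prob p (connEvent ends t l ∩ ((connEvent ends h l)ᶜ ∩ (connEvent ends h t)ᶜ)) := by
  set Rp : Set (Config E) := (connEvent ends h l)ᶜ ∩ (connEvent ends h t)ᶜ with hRp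
  -- `P(PD) = P(R′) − P(t ↔ l, R′)`
  have hPD : prob p (Rp ∩ (connEvent ends t l)ᶜ) =
      prob p Rp - prob p (connEvent ends t l ∩ Rp) := by
    have := prob_inter_add_prob_inter_compl p Rp (connEvent ends t l)
    rw [Set.inter_comm Rp (connEvent ends t l)] at this
    linarith
  -- `M_h = P(h ↔ b, R′) − P(h ↔ b, t ↔ l, R′)`
  have hMh : prob p (Rp ∩ (connEvent ends t l)ᶜ ∩ connEvent ends h b) =
      prob p (connEvent ends h b ∩ Rp) -
        prob p (connEvent ends h b ∩ connEvent ends t l ∩ Rp) := by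
    have e1 : Rp ∩ (connEvent ends t l)ᶜ ∩ connEvent ends h b =
        connEvent ends h b ∩ Rp ∩ (connEvent ends t l)ᶜ := by
      ext ω
      simp only [Set.mem_inter_iff, Set.mem_compl_iff]
      tauto
    have e2 : connEvent ends h b ∩ connEvent ends t l ∩ Rp =
        connEvent ends h b ∩ Rp ∩ connEvent ends t l := by
      ext ω
      simp only [Set.mem_inter_iff]
      tauto
    rw [e1, e2]
    have := prob_inter_add_prob_inter_compl p (connEvent ends h b ∩ Rp) (connEvent ends t l)
    linarith
  have hcov := hf2_cov p hp ends h l t b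
  have hgap := hf2_gap_split p ends h l t b
  rw [← hRp] at hcov hgap
  -- the exact decomposition of the slack
  have key :
      (prob p (Rp ∩ (connEvent ends t l)ᶜ ∩ connEvent ends h b) +
            (prob p (connEvent ends h b ∩ ((connEvent ends h l)ᶜ ∩ connEvent ends h t)) -
              prob p (connEvent ends l b ∩ ((connEvent ends h l)ᶜ ∩ connEvent ends h t)))) *
          prob p Rp -
        prob p (connEvent ends l b ∩ Rp) * prob p (Rp ∩ (connEvent ends t l)ᶜ) =
      (prob p (connEvent ends h b ∩ Rp) * prob p (connEvent ends t l ∩ Rp) -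
          prob p (connEvent ends h b ∩ connEvent ends t l ∩ Rp) * prob p Rp) +
        (prob p (connEvent ends h b) - prob p (connEvent ends l b)) *
          prob p (Rp ∩ (connEvent ends t l)ᶜ) +
        (prob p (connEvent ends h b ∩ ((connEvent ends h l)ᶜ ∩ connEvent ends h t)) -
            prob p (connEvent ends l b ∩ ((connEvent ends h l)ᶜ ∩ connEvent ends h t))) *
          prob p (connEvent ends t l ∩ Rp) := by
    rw [hMh, hPD]
    have hA : prob p (connEvent ends h b ∩ Rp) =
        (prob p (connEvent ends h b) - prob p (connEvent ends l b)) +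
          prob p (connEvent ends l b ∩ Rp) -
          (prob p (connEvent ends h b ∩ ((connEvent ends h l)ᶜ ∩ connEvent ends h t)) -
            prob p (connEvent ends l b ∩ ((connEvent ends h l)ᶜ ∩ connEvent ends h t))) := by
      linarith
    rw [hA]
    ring
  rw [ge_iff_le, ← sub_nonneg, key]
  have h1 : 0 ≤ prob p (connEvent ends h b ∩ Rp) * prob p (connEvent ends t l ∩ Rp) -
      prob p (connEvent ends h b ∩ connEvent ends t l ∩ Rp) * prob p Rp := by
    linarith
  linarith

/-- **`Δ_T ≥ 0` under the labelling** (R10 with the increasing `C_h`-event `{t ∈ C_h}`; quantitative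
R10 `orderPreserving_quant_mul` at `s = h`, `o = t`, `y = l`):
`P(l ↔ b) ≤ P(h ↔ b)` implies `P(l ↔ b, T) ≤ P(h ↔ b, T)`, `T = {h ↮ l, h ↔ t}`. -/
theorem hf2_deltaT_nonneg (p : E → R) (hp : IsProbVec p) (ends : E → Sym2 V) (h l t b : V)
    (hlab : prob p (connEvent ends l b) ≤ prob p (connEvent ends h b)) :
    0 ≤ prob p (connEvent ends h b ∩ ((connEvent ends h l)ᶜ ∩ connEvent ends h t)) -
      prob p (connEvent ends l b ∩ ((connEvent ends h l)ᶜ ∩ connEvent ends h t)) := by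
  have key := orderPreserving_quant_mul p hp ends h t l b
  rw [hf2_triangle_empty, prob_empty, sub_zero] at key
  have e1 : connEvent ends h t ∩ connEvent ends h b ∩ (connEvent ends h l)ᶜ =
      connEvent ends h b ∩ ((connEvent ends h l)ᶜ ∩ connEvent ends h t) := by
    ext ω
    simp only [Set.mem_inter_iff, Set.mem_compl_iff]
    tauto
  have e2 : connEvent ends h t ∩ (connEvent ends h l)ᶜ ∩ connEvent ends l b =
      connEvent ends l b ∩ ((connEvent ends h l)ᶜ ∩ connEvent ends h t) := by
    ext ω
    simp only [Set.mem_inter_iff, Set.mem_compl_iff]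
    tauto
  rw [e1, e2] at key
  have hT0 : 0 ≤ prob p (connEvent ends h t ∩ (connEvent ends h l)ᶜ) := prob_nonneg hp _
  have hL : 0 ≤ (prob p (connEvent ends h b ∩ ((connEvent ends h l)ᶜ ∩ connEvent ends h t)) -
      prob p (connEvent ends l b ∩ ((connEvent ends h l)ᶜ ∩ connEvent ends h t))) *
        prob p (connEvent ends h l)ᶜ :=
    le_trans (mul_nonneg hT0 (by linarith)) key
  rcases (prob_nonneg hp (connEvent ends h l)ᶜ).lt_or_eq with hpos | hzero
  · exact nonneg_of_mul_nonneg_left hL hpos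
  · -- `P(h ↮ l) = 0`: both `T`-masses vanish
    have hsub : ∀ A : Set (Config E),
        prob p (A ∩ ((connEvent ends h l)ᶜ ∩ connEvent ends h t)) = 0 := fun A =>
      le_antisymm (by
        calc prob p (A ∩ ((connEvent ends h l)ᶜ ∩ connEvent ends h t)) ≤
              prob p (connEvent ends h l)ᶜ := prob_mono hp fun ω hω => hω.2.1
          _ = 0 := hzero.symm) (prob_nonneg hp _)
    rw [hsub, hsub]
    simp

/-- **HF2** (CONJECTURES row 2′H, now a theorem): for roots `b, l, h, t` with the labelling
`P(l ↔ b) ≤ P(h ↔ b)`, `R′ = {h ↮ l, h ↮ t}`, `PD = R′ ∩ {t ↮ l}`, `T = {h ↮ l, h ↔ t}`: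
`P(l ↔ b, R′) · P(PD) ≤ (P(PD, h ↔ b) + (P(h ↔ b, T) − P(l ↔ b, T))) · P(R′)`. -/
theorem hf2 (p : E → R) (hp : IsProbVec p) (ends : E → Sym2 V) (h l t b : V)
    (hlab : prob p (connEvent ends l b) ≤ prob p (connEvent ends h b)) :
    prob p (connEvent ends l b ∩ ((connEvent ends h l)ᶜ ∩ (connEvent ends h t)ᶜ)) *
        prob p ((connEvent ends h l)ᶜ ∩ (connEvent ends h t)ᶜ ∩ (connEvent ends t l)ᶜ) ≤
      (prob p ((connEvent ends h l)ᶜ ∩ (connEvent ends h t)ᶜ ∩ (connEvent ends t l)ᶜ ∩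
            connEvent ends h b) +
          (prob p (connEvent ends h b ∩ ((connEvent ends h l)ᶜ ∩ connEvent ends h t)) -
            prob p (connEvent ends l b ∩ ((connEvent ends h l)ᶜ ∩ connEvent ends h t)))) *
        prob p ((connEvent ends h l)ᶜ ∩ (connEvent ends h t)ᶜ) := by
  have hs := hf2_slack_ge p hp ends h l t b
  have hDT := hf2_deltaT_nonneg p hp ends h l t b hlab
  have h1 := mul_nonneg (sub_nonneg.2 hlab)
    (prob_nonneg hp ((connEvent ends h l)ᶜ ∩ (connEvent ends h t)ᶜ ∩ (connEvent ends t l)ᶜ))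
  have h2 := mul_nonneg hDT
    (prob_nonneg hp (connEvent ends t l ∩ ((connEvent ends h l)ᶜ ∩ (connEvent ends h t)ᶜ)))
  linarith

/-- **HF2, quantitative**: under the labelling the HF2 slack is at least
`gap · P(PD) + Δ_T · P(t ↔ l, R′)`, with `gap = P(h ↔ b) − P(l ↔ b) ≥ 0` and `Δ_T ≥ 0`. -/
theorem hf2_quant (p : E → R) (hp : IsProbVec p) (ends : E → Sym2 V) (h l t b : V)
    (hlab : prob p (connEvent ends l b) ≤ prob p (connEvent ends h b)) :
    prob p (connEvent ends l b ∩ ((connEvent ends h l)ᶜ ∩ (connEvent ends h t)ᶜ)) *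
          prob p ((connEvent ends h l)ᶜ ∩ (connEvent ends h t)ᶜ ∩ (connEvent ends t l)ᶜ) +
        (prob p (connEvent ends h b) - prob p (connEvent ends l b)) *
          prob p ((connEvent ends h l)ᶜ ∩ (connEvent ends h t)ᶜ ∩ (connEvent ends t l)ᶜ) +
        (prob p (connEvent ends h b ∩ ((connEvent ends h l)ᶜ ∩ connEvent ends h t)) -
            prob p (connEvent ends l b ∩ ((connEvent ends h l)ᶜ ∩ connEvent ends h t))) *
          prob p (connEvent ends t l ∩ ((connEvent ends h l)ᶜ ∩ (connEvent ends h t)ᶜ)) ≤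
      (prob p ((connEvent ends h l)ᶜ ∩ (connEvent ends h t)ᶜ ∩ (connEvent ends t l)ᶜ ∩
            connEvent ends h b) +
          (prob p (connEvent ends h b ∩ ((connEvent ends h l)ᶜ ∩ connEvent ends h t)) -
            prob p (connEvent ends l b ∩ ((connEvent ends h l)ᶜ ∩ connEvent ends h t)))) *
        prob p ((connEvent ends h l)ᶜ ∩ (connEvent ends h t)ᶜ) := by
  have hs := hf2_slack_ge p hp ends h l t b
  have _hDT := hf2_deltaT_nonneg p hp ends h l t b hlab
  linarith

end HF2

end Summit.Ventures.PercRepro2
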